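import Summits.AtomisticToContinuum.HydrodynamicLimit.Theorems.InformationPercolationEngineKickFairRelEquilibriumMesoCutCore
import Literature.Analysis.FluidPDE.RusinSverakGaugePatching

/-!
# `KickFairRelEquilibriumMeso`, line `Sketch` — glue T′ (the SHORT-FLIGHT CUT), part 2: the core estimate at fixed `N`

Helper file (`--supports stmt-AtomisticToContinuum-15177`, registered sub-goal `cutCoreEstimate`) of the line lead for
the glue stub `stub_cutTransfer`. For a CUT weight family `h` (weights vanish on collisions preceded by a flight `< t_N/A`),
`|Z_k| ≤ β = 2C_g(A+1)ε` on the good set for every kinetic window (part 1), so: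

`E_LG |S_h| ≤ m(δ′ + 1/L)t_N + m·Λs(β + δ′t_N)e^{-c(N+1)} + #keys · mβ e^{-η(N+1)} + mβ e^{-(N+1)}`

(`cut_core_estimate`): tile `(0, τ]` into `m` windows (`S = Σ_k Z_k`); the high-energy region `KE > K₀(N+1)` costs
`mβ · LG(KE > K₀(N+1)) ≤ mβ Λ^{N+1} G_{θ₁}(KE > K₀(N+1)) ≤ mβ e^{-(N+1)}` (global domination + E2 at rate `log Λ + 1`);
the low-energy region is covered by the level sets of the keys in `s` (KC); a non-kept level set (`LG(B) < e^{-η(N+1)}`)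
costs `mβ LG(B)`; a kept one costs `((δ′+1/L)t_N + Λs(β+δ′t_N)e^{-c(N+1)}) LG(B)` per window
(`cut_kept_window_bound` with the first conditional transfer of `transfers_on_levelSet`). No count tail anywhere.
-/

noncomputable section

open MeasureTheory Set Filter Topology
open scoped ENNReal Classical

namespace Summit.AtomisticToContinuum.HydrodynamicLimit.Theorems.KickFairRelEquilibriumMesoLine

open Literature.Analysis.FluidPDE Literature.MathematicalPhysics.KineticTheory
open Summit.AtomisticToContinuum.HydrodynamicLimit.Theorems

variable {σ : ℝ} {N : ℕ}

/-- **The core estimate at fixed `N`, cut version.** See the module docstring. [folklore] -/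
theorem cut_core_estimate (hPM : PastMeasurable) (hσ : 0 < σ) (hσ2 : σ ≤ 1 / 2) (Φ : Flow σ N)
    {a₀ θ₀ : T3 → ℝ} {u₀ : T3 → V3} (ha : Continuous a₀) (hθ : Continuous θ₀) (hu : Continuous u₀)
    (ha0 : ∀ x, 0 < a₀ x) (hθ0 : ∀ x, 0 < θ₀ x) {θ₁ Λ : ℝ} (hθ₁ : 0 < θ₁) (hΛ : 1 ≤ Λ)
    (hdomG : localGibbsMeasure σ a₀ u₀ θ₀ N ≤
      ENNReal.ofReal (Λ ^ (N + 1)) • localGibbsMeasure σ (fun _ => 1) (fun _ => (0 : V3)) (fun _ => θ₁) N)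
    {τ : ℝ} (hτ : 0 < τ) {g : V3 × V3 × V3 → ℝ} (hg : Continuous g) {Cg : ℝ} (hCg : ∀ p, |g p| ≤ Cg)
    {h : Fin (N + 1) → ℕ → Past N → ℝ} (hh : ∀ i n, Measurable (h i n)) (hhb : ∀ i n p, |h i n p| ≤ 1)
    {A : ℝ} (hA : 0 < A) (hcut : ∀ i n p, p.2.2.2 - p.2.1 < tN N / A → h i n p = 0)
    {K₀ M₂ : ℝ}
    (hE2N : localGibbsLaw σ (fun _ => 1) (fun _ => 0) (fun _ => θ₁) N Φ {z | K₀ * ((N : ℝ) + 1) < kinEnergy z} ≤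
      ENNReal.ofReal (Real.exp (-(M₂ * ((N : ℝ) + 1)))))
    {ηp : ℝ} (hηp : 0 < ηp)
    (hS1N : ∀ z z' : Phase N, cellKey (rs N) (rs N) z = cellKey (rs N) (rs N) z' →
      canonicalDensity (Torus.geometry (Fin 3)) (hsDiameter σ N) (N + 1) (localGibbsProfile a₀ u₀ θ₀) z *
        canonicalDensity (Torus.geometry (Fin 3)) (hsDiameter σ N) (N + 1)
          (localGibbsProfile (fun _ => 1) (fun _ => 0) (fun _ => 1)) z' ≤
      Real.exp (ηp * (((N : ℝ) + 1) + kinEnergy z + kinEnergy z')) *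
        (canonicalDensity (Torus.geometry (Fin 3)) (hsDiameter σ N) (N + 1) (localGibbsProfile a₀ u₀ θ₀) z' *
          canonicalDensity (Torus.geometry (Fin 3)) (hsDiameter σ N) (N + 1)
            (localGibbsProfile (fun _ => 1) (fun _ => 0) (fun _ => 1)) z))
    (hS2N : ∀ z z' : Phase N, cellKey (rs N) (rs N) z = cellKey (rs N) (rs N) z' →
      canonicalDensity (Torus.geometry (Fin 3)) (hsDiameter σ N) (N + 1)
          (localGibbsProfile (fun _ => 1) (fun _ => 0) (fun _ => θ₁)) z *
        canonicalDensity (Torus.geometry (Fin 3)) (hsDiameter σ N) (N + 1)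
          (localGibbsProfile (fun _ => 1) (fun _ => 0) (fun _ => 1)) z' ≤
      Real.exp (ηp * (((N : ℝ) + 1) + kinEnergy z + kinEnergy z')) *
        (canonicalDensity (Torus.geometry (Fin 3)) (hsDiameter σ N) (N + 1)
            (localGibbsProfile (fun _ => 1) (fun _ => 0) (fun _ => θ₁)) z' *
          canonicalDensity (Torus.geometry (Fin 3)) (hsDiameter σ N) (N + 1)
            (localGibbsProfile (fun _ => 1) (fun _ => 0) (fun _ => 1)) z))
    (s : Finset ((Fin 3 → ℤ) → ℕ × (Fin 3 → ℤ) × ℤ))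
    (hs : ∀ z : Phase N, kinEnergy z ≤ K₀ * ((N : ℝ) + 1) → cellKey (rs N) (rs N) z ∈ s)
    {δ' L c η : ℝ} (hδ' : 0 < δ') (hL : 0 < L)
    {m : ℕ} (hm : 0 < m) (hwlen : ∀ k, k < m → wEnd τ m (k + 1) ≤ wEnd τ m k + tN N)
    (hRN : ∀ k, k < m → ∀ z₀ : Phase N,
      ENNReal.ofReal (Real.exp (-(η * ((N : ℝ) + 1)))) ≤ localGibbsLaw σ a₀ u₀ θ₀ N Φ (keyLevel N z₀) →
      |∫ z in keyLevel N z₀, slotSum Φ τ (rs N) (wEnd τ m k) (wEnd τ m (k + 1)) g h z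
          ∂(localGibbsLaw σ (fun _ => 1) (fun _ => 0) (fun _ => 1) N Φ)| ≤
        δ' * tN N * (localGibbsLaw σ (fun _ => 1) (fun _ => 0) (fun _ => 1) N Φ (keyLevel N z₀)).toReal ∧
      localGibbsLaw σ (fun _ => 1) (fun _ => 0) (fun _ => 1) N Φ
          (keyLevel N z₀ ∩ {z | tN N / L < |slotSum Φ τ (rs N) (wEnd τ m k) (wEnd τ m (k + 1)) g h z -
              (localGibbsLaw σ (fun _ => 1) (fun _ => 0) (fun _ => 1) N Φ (keyLevel N z₀)).toReal⁻¹ *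
                ∫ z in keyLevel N z₀, slotSum Φ τ (rs N) (wEnd τ m k) (wEnd τ m (k + 1)) g h z
                  ∂(localGibbsLaw σ (fun _ => 1) (fun _ => 0) (fun _ => 1) N Φ)|}) ≤
        ENNReal.ofReal (Real.exp (-(c * ((N : ℝ) + 1)))) *
          localGibbsLaw σ (fun _ => 1) (fun _ => 0) (fun _ => 1) N Φ (keyLevel N z₀))
    (hM₂ : Real.log Λ + 1 ≤ M₂) :
    ∫⁻ z, ENNReal.ofReal |fullSum Φ τ (rs N) g h z| ∂(localGibbsLaw σ a₀ u₀ θ₀ N Φ) ≤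
      ENNReal.ofReal ((m : ℝ) * ((δ' + 1 / L) * tN N)) +
      ENNReal.ofReal ((m : ℝ) * (Real.exp (ηp * (1 + 2 * (K₀ + 1)) * ((N : ℝ) + 1)) *
        (2 * Cg * (A + 1) * hsDiameter σ N + δ' * tN N) * Real.exp (-(c * ((N : ℝ) + 1))))) +
      ENNReal.ofReal ((s.card : ℝ) * ((m : ℝ) * (2 * Cg * (A + 1) * hsDiameter σ N) *
        Real.exp (-(η * ((N : ℝ) + 1))))) +
      ENNReal.ofReal ((m : ℝ) * (2 * Cg * (A + 1) * hsDiameter σ N) * Real.exp (-((N : ℝ) + 1))) := by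
  set β : ℝ := 2 * Cg * (A + 1) * hsDiameter σ N with hβ
  set Λs : ℝ := Real.exp (ηp * (1 + 2 * (K₀ + 1)) * ((N : ℝ) + 1)) with hΛs
  set KX : ℝ := Λs * (β + δ' * tN N) * Real.exp (-(c * ((N : ℝ) + 1))) with hKX
  set NK : ℝ := (m : ℝ) * β * Real.exp (-(η * ((N : ℝ) + 1))) with hNK
  set μ : Measure (Phase N) := localGibbsLaw σ a₀ u₀ θ₀ N Φ with hμdef
  set ν : Measure (Phase N) := localGibbsLaw σ (fun _ => 1) (fun _ => 0) (fun _ => 1) N Φ with hνdef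
  set ν' : Measure (Phase N) := localGibbsLaw σ (fun _ => 1) (fun _ => 0) (fun _ => θ₁) N Φ with hν'def
  have hCg0 : 0 ≤ Cg := (abs_nonneg _).trans (hCg 0)
  have hε0 : 0 ≤ hsDiameter σ N := (hsDiameter_pos hσ N).le
  have hβ0 : 0 ≤ β := by positivity
  have hΛs0 : 0 ≤ Λs := (Real.exp_pos _).le
  have htN0 := (tN_pos N).le
  have hKX0 : 0 ≤ KX := by positivity
  have hNK0 : 0 ≤ NK := by positivity
  haveI hμP : IsProbabilityMeasure μ := isProbabilityMeasure_localGibbsLaw ha hθ hu ha0 hθ0 hσ2 N Φ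
  have hμν : μ ≪ ν := localGibbsLaw_absolutelyContinuous_localGibbsLaw continuous_const continuous_const
    continuous_const (fun _ => one_pos) (fun _ => one_pos) a₀ u₀ θ₀ hσ2 N Φ
  have hdom : μ ≤ ENNReal.ofReal (Λ ^ (N + 1)) • ν' := by
    rw [hμdef, hν'def, localGibbsLaw_eq, localGibbsLaw_eq]; exact hdomG
  have hμg : μ Φ.goodᶜ = 0 := localGibbsLaw_compl_good_eq_zero Φ
  have hνg : ν Φ.goodᶜ = 0 := localGibbsLaw_compl_good_eq_zero Φ
  have hgoodμ : ∀ᵐ z ∂μ, z ∈ Φ.good := mem_ae_iff.2 hμg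
  have hgoodν : ∀ᵐ z ∂ν, z ∈ Φ.good := mem_ae_iff.2 hνg
  have hκν : ∀ᵐ z ∂ν, ∀ i : Fin (N + 1), ∀ n : ℕ, |kappa Φ (rs N) g i n z| ≤ Cg :=
    ae_forall_abs_kappa_le Φ (rs N) hCg
  have hκμ : ∀ᵐ z ∂μ, ∀ i : Fin (N + 1), ∀ n : ℕ, |kappa Φ (rs N) g i n z| ≤ Cg := hμν.ae_le hκν
  -- windows and the a.e. bound |Z_k| ≤ β
  set Z : ℕ → Phase N → ℝ := fun k => slotSum Φ τ (rs N) (wEnd τ m k) (wEnd τ m (k + 1)) g h with hZdef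
  have hF : ∀ k, AEMeasurable (fun z => ENNReal.ofReal |Z k z|) μ := fun k =>
    (continuous_abs.measurable.comp_aemeasurable
      (aestronglyMeasurable_slotSum hPM hσ Φ τ (rs N) _ _ hg hh hμg).aemeasurable).ennreal_ofReal
  have hZβ_of : ∀ {z : Phase N}, z ∈ Φ.good → (∀ i : Fin (N + 1), ∀ n : ℕ, |kappa Φ (rs N) g i n z| ≤ Cg) →
      ∀ k, k < m → |Z k z| ≤ β := fun hz hκz k hk =>
    abs_slotSum_le_of_cut Φ hσ τ (rs N) hA (hwlen k hk) hCg hhb hcut hz hκz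
  have hZβμ : ∀ᵐ z ∂μ, ∀ k, k < m → |Z k z| ≤ β := by
    filter_upwards [hgoodμ, hκμ] with z hz hκz using hZβ_of hz hκz
  have hZβν : ∀ k, k < m → ∀ᵐ z ∂ν, |Z k z| ≤ β := fun k hk => by
    filter_upwards [hgoodν, hκν] with z hz hκz using hZβ_of hz hκz k hk
  -- |S| ≤ Σ_k |Z_k| pointwise, and Σ_k ∫_A |Z_k| ≤ m β μ(A) for every A
  have hsumA : ∀ Aset : Set (Phase N), ∫⁻ z in Aset, ENNReal.ofReal |fullSum Φ τ (rs N) g h z| ∂μ ≤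
      ∑ k ∈ Finset.range m, ∫⁻ z in Aset, ENNReal.ofReal |Z k z| ∂μ := fun Aset => by
    rw [← lintegral_finsetSum' _ fun k _ => (hF k).restrict]
    refine lintegral_mono fun z => ?_
    rw [fullSum_eq_sum_slotSum Φ hτ (rs N) g h hm z, ← ENNReal.ofReal_sum_of_nonneg fun k _ => abs_nonneg _]
    exact ENNReal.ofReal_le_ofReal (Finset.abs_sum_le_sum_abs _ _)
  have hwinA : ∀ Aset : Set (Phase N), ∀ k ∈ Finset.range m,
      ∫⁻ z in Aset, ENNReal.ofReal |Z k z| ∂μ ≤ ENNReal.ofReal β * μ Aset := fun Aset k hk => by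
    have hk' := Finset.mem_range.1 hk
    calc ∫⁻ z in Aset, ENNReal.ofReal |Z k z| ∂μ ≤ ∫⁻ _ in Aset, ENNReal.ofReal β ∂μ := by
          refine lintegral_mono_ae (ae_restrict_of_ae ?_)
          filter_upwards [hZβμ] with z hz using ENNReal.ofReal_le_ofReal (hz k hk')
      _ = ENNReal.ofReal β * μ Aset := setLIntegral_const _ _
  have hmβA : ∀ Aset : Set (Phase N), ∑ k ∈ Finset.range m, ∫⁻ z in Aset, ENNReal.ofReal |Z k z| ∂μ ≤
      (m : ℝ≥0∞) * ENNReal.ofReal β * μ Aset := fun Aset => by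
    calc ∑ k ∈ Finset.range m, ∫⁻ z in Aset, ENNReal.ofReal |Z k z| ∂μ
        ≤ ∑ _k ∈ Finset.range m, ENNReal.ofReal β * μ Aset := Finset.sum_le_sum (hwinA Aset)
      _ = (m : ℝ≥0∞) * ENNReal.ofReal β * μ Aset := by
          rw [Finset.sum_const, Finset.card_range, nsmul_eq_mul, mul_assoc]
  /- Step 1: split at the energy cap -/
  set lowE : Set (Phase N) := {z | kinEnergy z ≤ K₀ * ((N : ℝ) + 1)} with hlowE
  have hlowEm : MeasurableSet lowE := measurableSet_le measurable_kinEnergy measurable_const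
  have hlowEc : lowEᶜ = {z | K₀ * ((N : ℝ) + 1) < kinEnergy z} := by ext z; simp [hlowE, not_le]
  rw [← lintegral_add_compl (fun z => ENNReal.ofReal |fullSum Φ τ (rs N) g h z|) hlowEm]
  /- Step 2: the high-energy region -/
  have hHIGH : ∫⁻ z in lowEᶜ, ENNReal.ofReal |fullSum Φ τ (rs N) g h z| ∂μ ≤
      ENNReal.ofReal ((m : ℝ) * β * Real.exp (-((N : ℝ) + 1))) := by
    have h1 : μ lowEᶜ ≤ ENNReal.ofReal (Real.exp (-((N : ℝ) + 1))) := by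
      have hd : μ lowEᶜ ≤ ENNReal.ofReal (Λ ^ (N + 1)) * ν' lowEᶜ := by
        have := Measure.le_iff'.1 hdom lowEᶜ
        simpa [Measure.smul_apply, smul_eq_mul] using this
      have h4 : ν' lowEᶜ ≤ ENNReal.ofReal (Real.exp (-(M₂ * ((N : ℝ) + 1)))) := by rw [hlowEc]; exact hE2N
      have e2 : Λ ^ (N + 1) * Real.exp (-(M₂ * ((N : ℝ) + 1))) ≤ Real.exp (-(1 * ((N : ℝ) + 1))) :=
        pow_mul_exp_neg_le hΛ (by linarith) N
      rw [one_mul] at e2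
      calc μ lowEᶜ ≤ ENNReal.ofReal (Λ ^ (N + 1)) * ENNReal.ofReal (Real.exp (-(M₂ * ((N : ℝ) + 1)))) :=
            hd.trans (mul_le_mul_right h4 _)
        _ ≤ ENNReal.ofReal (Real.exp (-((N : ℝ) + 1))) := by
            rw [← ENNReal.ofReal_mul (by positivity)]
            exact ENNReal.ofReal_le_ofReal e2
    calc ∫⁻ z in lowEᶜ, ENNReal.ofReal |fullSum Φ τ (rs N) g h z| ∂μ
        ≤ (m : ℝ≥0∞) * ENNReal.ofReal β * μ lowEᶜ := (hsumA _).trans (hmβA _)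
      _ ≤ (m : ℝ≥0∞) * ENNReal.ofReal β * ENNReal.ofReal (Real.exp (-((N : ℝ) + 1))) := mul_le_mul_right h1 _
      _ = ENNReal.ofReal ((m : ℝ) * β * Real.exp (-((N : ℝ) + 1))) := by
          rw [← ENNReal.ofReal_natCast, ← ENNReal.ofReal_mul (Nat.cast_nonneg m),
            ← ENNReal.ofReal_mul (mul_nonneg (Nat.cast_nonneg m) hβ0)]
  /- Step 3: the low-energy region, into level sets -/
  set s' := s.filter (fun βk => ∃ z : Phase N, kinEnergy z ≤ K₀ * ((N : ℝ) + 1) ∧ cellKey (rs N) (rs N) z = βk)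
    with hs'
  set B : ((Fin 3 → ℤ) → ℕ × (Fin 3 → ℤ) × ℤ) → Set (Phase N) := fun βk => {z | cellKey (rs N) (rs N) z = βk}
    with hB
  have hBm : ∀ βk, MeasurableSet (B βk) := fun βk => measurableSet_cellKey_eq _ _ βk
  have hcover : lowE ⊆ ⋃ βk ∈ s', B βk := by
    intro z hz
    simp only [mem_iUnion, exists_prop]
    exact ⟨cellKey (rs N) (rs N) z, Finset.mem_filter.2 ⟨hs z hz, z, hz, rfl⟩, rfl⟩
  have hdisj : Set.PairwiseDisjoint (↑s' : Set ((Fin 3 → ℤ) → ℕ × (Fin 3 → ℤ) × ℤ)) B := by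
    intro βk _ βk' _ hne
    rw [Function.onFun, Set.disjoint_left]
    intro z hz hz'
    exact hne ((show cellKey (rs N) (rs N) z = βk from hz).symm.trans (show cellKey (rs N) (rs N) z = βk' from hz'))
  have hsumμ : ∑ βk ∈ s', μ (B βk) ≤ 1 := by
    rw [← measure_biUnion_finset hdisj fun βk _ => hBm βk]
    exact prob_le_one
  have hLOW2 : ∀ k, ∫⁻ z in lowE, ENNReal.ofReal |Z k z| ∂μ ≤ ∑ βk ∈ s', ∫⁻ z in B βk, ENNReal.ofReal |Z k z| ∂μ :=
    fun k => (lintegral_mono_set hcover).trans (Literature.Analysis.FluidPDE.lintegral_biUnion_finset_le μ s' B _)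
  /- Step 4: one level set -/
  have hlevel : ∀ βk ∈ s', ∑ k ∈ Finset.range m, ∫⁻ z in B βk, ENNReal.ofReal |Z k z| ∂μ ≤
      (m : ℝ≥0∞) * (ENNReal.ofReal ((δ' + 1 / L) * tN N) + ENNReal.ofReal KX) * μ (B βk) + ENNReal.ofReal NK := by
    intro βk hβk
    obtain ⟨z₀, hz₀E, rfl⟩ := (Finset.mem_filter.1 hβk).2
    have TB := fun F (hFm : Measurable F) =>
      (transfers_on_levelSet (σ := σ) (N := N) ha hθ hu ha0 hθ0 hθ₁ Φ hηp hS1N hS2N hz₀E hFm).1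
    change ∑ k ∈ Finset.range m, ∫⁻ z in keyLevel N z₀, ENNReal.ofReal |Z k z| ∂μ ≤
      (m : ℝ≥0∞) * (ENNReal.ofReal ((δ' + 1 / L) * tN N) + ENNReal.ofReal KX) * μ (keyLevel N z₀) + ENNReal.ofReal NK
    by_cases hkept : ENNReal.ofReal (Real.exp (-(η * ((N : ℝ) + 1)))) ≤ μ (keyLevel N z₀)
    · have hwin : ∀ k ∈ Finset.range m, ∫⁻ z in keyLevel N z₀, ENNReal.ofReal |Z k z| ∂μ ≤
          (ENNReal.ofReal ((δ' + 1 / L) * tN N) + ENNReal.ofReal KX) * μ (keyLevel N z₀) := by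
        intro k hk
        have hk' := Finset.mem_range.1 hk
        obtain ⟨hbias, hconc⟩ := hRN k hk' z₀ hkept
        exact cut_kept_window_bound hPM hσ hσ2 hg hh hβ0 (wEnd τ m k) (wEnd τ m (k + 1)) (hZβν k hk') hΛs0 TB
          hδ' hL hkept hbias hconc
      calc ∑ k ∈ Finset.range m, ∫⁻ z in keyLevel N z₀, ENNReal.ofReal |Z k z| ∂μ
          ≤ ∑ _k ∈ Finset.range m, (ENNReal.ofReal ((δ' + 1 / L) * tN N) + ENNReal.ofReal KX) * μ (keyLevel N z₀) :=
            Finset.sum_le_sum hwin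
        _ = (m : ℝ≥0∞) * (ENNReal.ofReal ((δ' + 1 / L) * tN N) + ENNReal.ofReal KX) * μ (keyLevel N z₀) := by
            rw [Finset.sum_const, Finset.card_range, nsmul_eq_mul]; ring
        _ ≤ _ := le_self_add
    · rw [not_le] at hkept
      calc ∑ k ∈ Finset.range m, ∫⁻ z in keyLevel N z₀, ENNReal.ofReal |Z k z| ∂μ
          ≤ (m : ℝ≥0∞) * ENNReal.ofReal β * μ (keyLevel N z₀) := hmβA _
        _ ≤ (m : ℝ≥0∞) * ENNReal.ofReal β * ENNReal.ofReal (Real.exp (-(η * ((N : ℝ) + 1)))) :=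
            mul_le_mul_right hkept.le _
        _ = ENNReal.ofReal NK := by
            rw [hNK, ← ENNReal.ofReal_natCast, ← ENNReal.ofReal_mul (Nat.cast_nonneg m),
              ← ENNReal.ofReal_mul (mul_nonneg (Nat.cast_nonneg m) hβ0)]
        _ ≤ _ := le_add_self
  /- Step 5: sums -/
  have hLOW : ∫⁻ z in lowE, ENNReal.ofReal |fullSum Φ τ (rs N) g h z| ∂μ ≤
      ENNReal.ofReal ((m : ℝ) * ((δ' + 1 / L) * tN N)) + ENNReal.ofReal ((m : ℝ) * KX) +
        ENNReal.ofReal ((s.card : ℝ) * NK) := by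
    calc ∫⁻ z in lowE, ENNReal.ofReal |fullSum Φ τ (rs N) g h z| ∂μ
        ≤ ∑ k ∈ Finset.range m, ∑ βk ∈ s', ∫⁻ z in B βk, ENNReal.ofReal |Z k z| ∂μ :=
          (hsumA _).trans (Finset.sum_le_sum fun k _ => hLOW2 k)
      _ = ∑ βk ∈ s', ∑ k ∈ Finset.range m, ∫⁻ z in B βk, ENNReal.ofReal |Z k z| ∂μ := Finset.sum_comm
      _ ≤ ∑ βk ∈ s', ((m : ℝ≥0∞) * (ENNReal.ofReal ((δ' + 1 / L) * tN N) + ENNReal.ofReal KX) * μ (B βk) +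
            ENNReal.ofReal NK) := Finset.sum_le_sum hlevel
      _ = (m : ℝ≥0∞) * (ENNReal.ofReal ((δ' + 1 / L) * tN N) + ENNReal.ofReal KX) * ∑ βk ∈ s', μ (B βk) +
            (s'.card : ℝ≥0∞) * ENNReal.ofReal NK := by
          rw [Finset.sum_add_distrib, ← Finset.mul_sum, Finset.sum_const, nsmul_eq_mul]
      _ ≤ (m : ℝ≥0∞) * (ENNReal.ofReal ((δ' + 1 / L) * tN N) + ENNReal.ofReal KX) * 1 +
            (s.card : ℝ≥0∞) * ENNReal.ofReal NK := by
          refine add_le_add (mul_le_mul_right hsumμ _) (mul_le_mul_left ?_ _)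
          exact_mod_cast Finset.card_filter_le _ _
      _ = ENNReal.ofReal ((m : ℝ) * ((δ' + 1 / L) * tN N)) + ENNReal.ofReal ((m : ℝ) * KX) +
            ENNReal.ofReal ((s.card : ℝ) * NK) := by
          rw [mul_one, mul_add, ENNReal.ofReal_mul (by positivity : (0 : ℝ) ≤ m),
            ENNReal.ofReal_mul (by positivity : (0 : ℝ) ≤ m), ENNReal.ofReal_mul (by positivity : (0 : ℝ) ≤ s.card),
            ENNReal.ofReal_natCast, ENNReal.ofReal_natCast]
  have hfinal := add_le_add hLOW hHIGH
  refine hfinal.trans (le_of_eq ?_)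
  rw [hKX, hNK, hΛs, hβ]

/-- **Registered sub-goal `cutCoreEstimate` of the glue T′ (part 2)**: a binder-free corollary recorded for the gate —
for a cut weight family the windowed kick sums of ALL windows of a tiling of mesh `≤ t_N` are bounded by
`2C(A+1)ε` on the good set where `|κ| ≤ C` (the pointwise input of `cut_core_estimate`). [folklore] -/
theorem cutCoreEstimate : ∀ (σ : ℝ) (N : ℕ) (Φ : Flow σ N) (τ A : ℝ) (m : ℕ) (g : V3 × V3 × V3 → ℝ) (C : ℝ)
    (h : Fin (N + 1) → ℕ → Past N → ℝ) (z : Phase N), 0 < σ → 0 < A →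
    (∀ k, k < m → wEnd τ m (k + 1) ≤ wEnd τ m k + tN N) → (∀ p, |g p| ≤ C) → (∀ i n p, |h i n p| ≤ 1) →
    (∀ i n p, p.2.2.2 - p.2.1 < tN N / A → h i n p = 0) → z ∈ Φ.good →
    (∀ i : Fin (N + 1), ∀ n : ℕ, |kappa Φ (rs N) g i n z| ≤ C) →
    ∀ k, k < m → |slotSum Φ τ (rs N) (wEnd τ m k) (wEnd τ m (k + 1)) g h z| ≤ 2 * C * (A + 1) * hsDiameter σ N :=
  fun _ N Φ τ _ _ _ _ _ _ hσ hA hwlen hg hhb hcut hz hκ k hk =>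
    abs_slotSum_le_of_cut Φ hσ τ (rs N) hA (hwlen k hk) hg hhb hcut hz hκ

end Summit.AtomisticToContinuum.HydrodynamicLimit.Theorems.KickFairRelEquilibriumMesoLine

end
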